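import Summits.CriticalPhenomena.PercolationContinuityZ3.Theorems.PercNearOneGluingNoHeavyQuantChiFLowerBound
import Summits.CriticalPhenomena.PercolationContinuityZ3.Theorems.PercNearOneGluingNoHeavyQuantHighDimRows
import Summits.CriticalPhenomena.PercolationContinuityZ3.Theorems.PercNearOneGluingNoHeavyQuantThetaModulusClosedForm
import Summits.CriticalPhenomena.PercolationContinuityZ3.Theorems.PercNearOneGluingNoHeavyLowerTailCSHTheoremOne
import Literature.Probability.Percolation.ThetaContinuity
import HarnessLib

/-!
# Divergence of the finite-cluster susceptibility at `p_c⁺` in every dimension, and its rate from a (T2) modulus: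
# `χ^f(p) ≥ c/θ(p) ≥ c/ω(p - p_c)` — quant lane, METHOD = differential inequalities near `p_c`, seat p4 gen 6

builds on p205010 (kernel theorem, internal audit signed; external expert review pending).
Status sentence for p205010: "θ(p_c) = 0 on ℤ^d, all d ≥ 2 — kernel-verified (Lean 4/Mathlib, standard axioms); internal
adversarial audit SIGNED 2026-08-20 04:29Z; external expert review pending."

Seat `prim-quant-p4`, `--supports stmt-CriticalPhenomena-4575`; pure proofs, no definitions.  Consequences of Theorem B of
`…QuantChiFLowerBound` (`χ^f(p) ≥ (1-p)(1-θ(p))/(2dpθ(p))`, from the Aizenman–Barsky inequalities) in the lane's vocabulary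
(`Quant.ThetaModulusNearCritical`, `Quant.ThetaHolderNearCritical`, `TriangleCondition`):

* `ChiF.chiF_ge_supercritical` — the bound throughout `p_c < p < 1`, `d ≥ 2`.
* **`ChiF.tendsto_meanClusterSize_nhdsGT_criticalProbI`** — `χ^f(p) → ∞` as `p ↓ p_c(ℤ^d)`, every `d ≥ 2` (right-continuity of `θ`,
  Grimmett Lemma (8.9), tree `theta_continuousWithinAt_Ici`; and `θ(p_c) = 0`, p205010 `CSH.percolationContinuity_allDimensions`).
  The QUALITATIVE divergence is elementary given `θ(p_c) = 0` (lower semicontinuity of `χ^f = Σ_n n P_p(|C| = n)` and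
  `χ^f(p_c) = χ(p_c) = ∞`); the content here is the RATE:
* **`ChiF.chiF_ge_of_thetaModulusNearCritical`** — a (T2) modulus `θ ≤ ω(p - p_c)` gives `χ^f(p) ≥ (1-p)(1-ω)/(2dpω)` at `ω = ω(p-p_c)`;
  with the lane's explicit modulus (`ThetaModulus.theta_le_kn_sum`, p4 gen 2) **`ChiF.chiF_ge_explicit_kn`**: for `d ≥ 3` an EXPLICIT
  function tending to `∞` as `p ↓ p_c` (iterated-logarithm class — an explicit function and nothing more).
* **`ChiF.chiF_ge_of_thetaHolderNearCritical`** — `ThetaHolderNearCritical d b C` ⇒ `χ^f(p) ≥ c_{d,C}(p)(p - p_c)^{-b}` ("`γ' ≥ β`" as an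
  inequality with constants; conditional on the Hölder instance, which is OPEN for `3 ≤ d ≤ 10`; kernel at `d = 2` with `b = 2⁻¹^158`).
* **`ChiF.chiF_ge_of_triangle`** — under `TriangleCondition d` (tree: `β = 1` bounded-ratio, Barsky–Aizenman 1991 via Hutchcroft 2022),
  `∃ C > 0, χ^f(p) ≥ (1-p)(1-C(p-p_c))/(2dpC(p-p_c))` on `(p_c, 1)`: the one-sided mean-field bound "`γ' ≥ 1`" as an inequality
  `χ^f(p) ≥ c/(p-p_c)` near `p_c⁺`.  Heydenreich–van der Hofstad 2017, Open Problem 11.1, asks for existence and value of `γ'`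
  (`= γ = 1`); Hutchcroft 2022 (PLMS, §1, §5): "almost no progress has been made on the slightly supercritical cases".  We claim only this
  one-sided inequality, a three-line consequence of Aizenman–Barsky 1987 and `β ≤ 1`-type upper bounds; we found no printed statement of it.

## References
* G. Grimmett, *Percolation*, 2nd ed. (1999), §5.3, §8.3 Lemma (8.9), §10.4 notes (Newman's `γ' ≥ 2(1-δ⁻¹)`) [GrimmettPercolation1999].
* M. Aizenman, D. J. Barsky, Comm. Math. Phys. 108 (1987) 489–526 [AizenmanBarsky1987].
* M. Heydenreich, R. van der Hofstad (2017), Open Problem 11.1 [HeydenreichVanDerHofstad2017].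
* T. Hutchcroft, *Slightly supercritical percolation on non-amenable graphs I*, Proc. LMS (2022), arXiv:2002.02916, §1 and §5.
-/

noncomputable section

namespace Summit.CriticalPhenomena.PercolationContinuityZ3.Theorems

open MeasureTheory Set Filter Topology Literature.Probability.Percolation Literature.Probability.LatticeModels
open scoped Classical ENNReal

namespace ChiF

/-! ### §9. Corollaries in the lane's vocabulary: divergence of `χ^f` at `p_c⁺` and its rate from a (T2) modulus -/

section Corollaries

variable {d : ℕ}

/-- Monotone form of Theorem B: if `0 < θ(p) ≤ w` then `χ^f(p) ≥ (1-p)(1-w)/(2dpw)`. -/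
theorem chiF_ge_of_theta_le (hd : 1 ≤ d) (p : unitInterval) (hp0 : 0 < (p : ℝ)) (hp1 : (p : ℝ) < 1)
    (hθ : 0 < theta (zdGraph d) 0 p) {w : ℝ} (hw : theta (zdGraph d) 0 p ≤ w) :
    ENNReal.ofReal ((1 - (p : ℝ)) * (1 - w) / (2 * d * (p : ℝ) * w)) ≤ meanClusterSize (zdGraph d) (0 : Site d) p := by
  refine (ENNReal.ofReal_le_ofReal ?_).trans (chiF_ge_of_theta_pos hd p hp0 hp1 hθ)
  have hw0 : 0 < w := hθ.trans_le hw
  have hd' : (0 : ℝ) < d := by exact_mod_cast hd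
  have hdp : 0 < 2 * (d : ℝ) * p := by positivity
  rw [div_le_div_iff₀ (by positivity) (by positivity)]
  have h1 : (1 - w) * theta (zdGraph d) 0 p ≤ (1 - theta (zdGraph d) 0 p) * w := by nlinarith
  have h2 : 0 ≤ (1 - (p : ℝ)) * (2 * d * (p : ℝ)) := by nlinarith
  calc (1 - (p : ℝ)) * (1 - w) * (2 * d * (p : ℝ) * theta (zdGraph d) 0 p)
      = ((1 - (p : ℝ)) * (2 * d * (p : ℝ))) * ((1 - w) * theta (zdGraph d) 0 p) := by ring
    _ ≤ ((1 - (p : ℝ)) * (2 * d * (p : ℝ))) * ((1 - theta (zdGraph d) 0 p) * w) :=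
        mul_le_mul_of_nonneg_left h1 h2
    _ = (1 - (p : ℝ)) * (1 - theta (zdGraph d) 0 p) * (2 * d * (p : ℝ) * w) := by ring

/-- **`χ^f(p) ≥ (1-p)(1-θ(p))/(2dpθ(p))` throughout the supercritical phase `p_c < p < 1` of `ℤ^d`, `d ≥ 2`.** -/
theorem chiF_ge_supercritical (hd : 2 ≤ d) (p : unitInterval) (hpc : (criticalProbI d : ℝ) < p) (hp1 : (p : ℝ) < 1) :
    ENNReal.ofReal ((1 - (p : ℝ)) * (1 - theta (zdGraph d) 0 p) / (2 * d * (p : ℝ) * theta (zdGraph d) 0 p)) ≤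
      meanClusterSize (zdGraph d) (0 : Site d) p := by
  have hpc0 : 0 < (criticalProbI d : ℝ) := by
    rw [coe_criticalProbI]; exact criticalProb_zd_pos d (by omega)
  have hθ : 0 < theta (zdGraph d) 0 p :=
    theta_pos_of_criticalProb_lt_holds (zdGraph d) 0 p (by rw [← coe_criticalProbI]; exact hpc)
  exact chiF_ge_of_theta_pos (by omega) p (hpc0.trans hpc) hp1 hθ

/-- **The finite-cluster susceptibility diverges at `p_c` from above, in every dimension `d ≥ 2`:**
`χ^f(p) → ∞` as `p ↓ p_c(ℤ^d)`.  Inputs: `chiF_ge_supercritical`, right-continuity of `θ` (Grimmett Lemma (8.9),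
tree `theta_continuousWithinAt_Ici`) and `θ(p_c) = 0` (p205010, `CSH.percolationContinuity_allDimensions`).
builds on p205010 (kernel theorem, internal audit signed; external expert review pending).  (The qualitative divergence also
follows from lower semicontinuity of `χ^f` and `χ^f(p_c) = χ(p_c) = ∞`; the point of this file is the RATE `≥ c/θ(p)`.) -/
theorem tendsto_meanClusterSize_nhdsGT_criticalProbI (hd : 2 ≤ d) :
    Tendsto (fun p : unitInterval => meanClusterSize (zdGraph d) (0 : Site d) p) (𝓝[>] (criticalProbI d)) (𝓝 ⊤) := by
  have hpc0 : 0 < (criticalProbI d : ℝ) := by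
    rw [coe_criticalProbI]; exact criticalProb_zd_pos d (by omega)
  have hpc1 : (criticalProbI d : ℝ) < 1 := by
    rw [coe_criticalProbI]; exact criticalProb_zd_lt_one hd
  have hd1 : (0 : ℝ) < d := by
    have : 1 ≤ d := by omega
    exact_mod_cast this
  -- `θ(p) → 0` as `p ↓ p_c`
  have hθ0 : theta (zdGraph d) 0 (criticalProbI d) = 0 := CSH.percolationContinuity_allDimensions d hd
  have hθlim : Tendsto (fun q : unitInterval => theta (zdGraph d) 0 q) (𝓝[>] (criticalProbI d)) (𝓝 0) := by
    have h := (theta_continuousWithinAt_Ici (d := d) (criticalProbI d)).tendsto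
    rw [hθ0] at h
    exact h.mono_left (nhdsWithin_mono _ Set.Ioi_subset_Ici_self)
  rw [ENNReal.tendsto_nhds_top_iff_nnreal]
  intro R
  -- choose `ε` with `(1-p_c)/(8dε) > R`
  set ε : ℝ := min (1 / 2) ((1 - (criticalProbI d : ℝ)) / (8 * d * ((R : ℝ) + 1))) with hε
  have hε0 : 0 < ε := by
    rw [hε]; refine lt_min (by norm_num) (div_pos (by linarith) (by positivity))
  have hev1 : ∀ᶠ q : unitInterval in 𝓝[>] (criticalProbI d), theta (zdGraph d) 0 q < ε :=
    hθlim (Iio_mem_nhds hε0)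
  have hev2 : ∀ᶠ q : unitInterval in 𝓝[>] (criticalProbI d), (criticalProbI d : ℝ) < q :=
    eventually_nhdsWithin_of_forall fun q hq => hq
  have hev3 : ∀ᶠ q : unitInterval in 𝓝[>] (criticalProbI d), (q : ℝ) < (1 + criticalProbI d) / 2 := by
    have hopen : IsOpen {q : unitInterval | (q : ℝ) < (1 + criticalProbI d) / 2} :=
      isOpen_lt continuous_subtype_val continuous_const
    exact mem_nhdsWithin_of_mem_nhds (hopen.mem_nhds (by show (criticalProbI d : ℝ) < _; linarith))
  filter_upwards [hev1, hev2, hev3] with q hq1 hq2 hq3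
  have hq1' : (q : ℝ) < 1 := by linarith
  have hθq : 0 < theta (zdGraph d) 0 q :=
    theta_pos_of_criticalProb_lt_holds (zdGraph d) 0 q (by rw [← coe_criticalProbI]; exact hq2)
  refine lt_of_lt_of_le ?_ (chiF_ge_supercritical hd q hq2 hq1')
  have hq0' : 0 < (q : ℝ) := hpc0.trans hq2
  rw [← ENNReal.ofReal_coe_nnreal, ENNReal.ofReal_lt_ofReal_iff_of_nonneg NNReal.zero_le_coe]
  -- `R < (1-q)(1-θ)/(2dqθ)` since `1-q ≥ (1-p_c)/2`, `1-θ ≥ 1/2`, `q ≤ 1`, `θ < ε ≤ (1-p_c)/(8d(R+1))`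
  rw [lt_div_iff₀ (by positivity)]
  have hεle : ε ≤ (1 - (criticalProbI d : ℝ)) / (8 * d * ((R : ℝ) + 1)) := min_le_right _ _
  have hεhalf : ε ≤ 1 / 2 := min_le_left _ _
  have hR0 : (0 : ℝ) ≤ R := R.2
  have hθε : theta (zdGraph d) 0 q * (8 * d * ((R : ℝ) + 1)) < 1 - (criticalProbI d : ℝ) := by
    have := (lt_of_lt_of_le hq1 hεle)
    rwa [lt_div_iff₀ (by positivity)] at this
  have hq0 : (q : ℝ) ≤ 1 := q.2.2
  set θ := theta (zdGraph d) 0 q with hθdef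
  have h1 : (R : ℝ) * (2 * d * (q : ℝ) * θ) ≤ 2 * d * θ * ((R : ℝ) + 1) := by
    have hqR : (q : ℝ) * R ≤ (R : ℝ) + 1 := by nlinarith
    have h2dθ : 0 ≤ 2 * d * θ := by positivity
    calc (R : ℝ) * (2 * d * (q : ℝ) * θ) = (2 * d * θ) * ((q : ℝ) * R) := by ring
      _ ≤ (2 * d * θ) * ((R : ℝ) + 1) := mul_le_mul_of_nonneg_left hqR h2dθ
  have h2 : 2 * d * θ * ((R : ℝ) + 1) < (1 - (criticalProbI d : ℝ)) / 4 := by linarith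
  have h3 : (1 - (criticalProbI d : ℝ)) / 4 < (1 - (q : ℝ)) * (1 - θ) := by
    have hA : (1 - (criticalProbI d : ℝ)) / 2 < 1 - (q : ℝ) := by linarith
    have hB : (1 : ℝ) / 2 < 1 - θ := by linarith
    have := mul_lt_mul'' hA hB (by linarith) (by norm_num)
    linarith
  linarith

/-- **A (T2) modulus gives the divergence RATE of `χ^f`**: if `θ(p) ≤ ω(p - p_c)` for `p ≥ p_c` (`Quant.ThetaModulusNearCritical d ω`)
then `χ^f(p) ≥ (1-p)(1 - ω(p-p_c)) / (2dp ω(p-p_c))` for `p_c < p < 1`; with the lane's explicit (iterated-logarithm) modulus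
this is an EXPLICIT function tending to `∞` as `p ↓ p_c` — an explicit function and nothing more.
builds on p205010 (kernel theorem, internal audit signed; external expert review pending). -/
theorem chiF_ge_of_thetaModulusNearCritical (hd : 2 ≤ d) {ω : ℝ → ℝ} (hω : Quant.ThetaModulusNearCritical d ω)
    (p : unitInterval) (hpc : (criticalProbI d : ℝ) < p) (hp1 : (p : ℝ) < 1) :
    ENNReal.ofReal ((1 - (p : ℝ)) * (1 - ω ((p : ℝ) - criticalProbI d)) / (2 * d * (p : ℝ) * ω ((p : ℝ) - criticalProbI d))) ≤
      meanClusterSize (zdGraph d) (0 : Site d) p := by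
  have hpc0 : 0 < (criticalProbI d : ℝ) := by
    rw [coe_criticalProbI]; exact criticalProb_zd_pos d (by omega)
  have hθ : 0 < theta (zdGraph d) 0 p :=
    theta_pos_of_criticalProb_lt_holds (zdGraph d) 0 p (by rw [← coe_criticalProbI]; exact hpc)
  exact chiF_ge_of_theta_le (by omega) p (hpc0.trans hpc) hp1 hθ (hω.2 p hpc.le)

/-- **Hölder case ("`γ' ≥ β`" as an inequality with constants)**: `θ(p) ≤ C (p-p_c)^b` for `p ≥ p_c`
(`Quant.ThetaHolderNearCritical d b C`) gives `χ^f(p) ≥ (1-p)(1 - C(p-p_c)^b) / (2dpC (p-p_c)^b)` for `p_c < p < 1`, i.e.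
`χ^f(p) ≥ c (p - p_c)^{-b}` near `p_c`.  builds on p205010 (kernel theorem, internal audit signed; external expert review pending). -/
theorem chiF_ge_of_thetaHolderNearCritical (hd : 2 ≤ d) {b C : ℝ} (hH : Quant.ThetaHolderNearCritical d b C)
    (p : unitInterval) (hpc : (criticalProbI d : ℝ) < p) (hp1 : (p : ℝ) < 1) :
    ENNReal.ofReal ((1 - (p : ℝ)) * (1 - C * ((p : ℝ) - criticalProbI d) ^ b) /
        (2 * d * (p : ℝ) * (C * ((p : ℝ) - criticalProbI d) ^ b))) ≤
      meanClusterSize (zdGraph d) (0 : Site d) p := by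
  have hpc0 : 0 < (criticalProbI d : ℝ) := by
    rw [coe_criticalProbI]; exact criticalProb_zd_pos d (by omega)
  have hθ : 0 < theta (zdGraph d) 0 p :=
    theta_pos_of_criticalProb_lt_holds (zdGraph d) 0 p (by rw [← coe_criticalProbI]; exact hpc)
  exact chiF_ge_of_theta_le (by omega) p (hpc0.trans hpc) hp1 hθ (hH p hpc.le)

/-- **Triangle-condition dimensions (mean-field LOWER bound "`γ' ≥ 1`")**: under `TriangleCondition d` (tree: `β = 1` in the
bounded-ratio sense, `betaEqOneBoundedRatio_of_triangle`, Barsky–Aizenman 1991 / Hutchcroft 2022) there is `C > 0` with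
`χ^f(p) ≥ (1-p)(1 - C(p-p_c)) / (2dpC(p-p_c))` for all `p_c < p < 1`, i.e. `χ^f(p) ≥ c/(p - p_c)` near `p_c⁺`.  Heydenreich–van der
Hofstad 2017, Open Problem 11.1, asks for the existence and value of `γ'`; this is the one-sided half `γ' ≥ 1` as an inequality. -/
theorem chiF_ge_of_triangle (hd : 2 ≤ d) (hT : TriangleCondition d) :
    ∃ C : ℝ, 0 < C ∧ ∀ p : unitInterval, (criticalProbI d : ℝ) < p → (p : ℝ) < 1 →
      ENNReal.ofReal ((1 - (p : ℝ)) * (1 - C * ((p : ℝ) - criticalProbI d)) / (2 * d * (p : ℝ) * (C * ((p : ℝ) - criticalProbI d)))) ≤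
        meanClusterSize (zdGraph d) (0 : Site d) p := by
  obtain ⟨C, hC, hH⟩ := Quant.thetaHolderNearCritical_one_of_triangle hd hT
  refine ⟨C, hC, fun p hpc hp1 => ?_⟩
  have h := chiF_ge_of_thetaHolderNearCritical hd hH p hpc hp1
  simpa only [Real.rpow_one] using h

/-- **Explicit form on `ℤ^d`, `d ≥ 3`** (the lane's closed-form modulus `ThetaModulus.theta_le_kn_sum`): for `p_c < p ≤ p_c + 1/4`
and every `n`, with `B_n(p) = 2(1-η_d)^{I_d(n)} + 8d²(2n+1)^d (p-p_c)²` (`η_d = Quant.knEta d`, `I_d = Quant.iterCount (Quant.knLHi d)`):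
`χ^f(p) ≥ (1-p)(1 - B_n(p)) / (2dp B_n(p))`.  Optimising `n` as `p ↓ p_c` gives an explicit function tending to `∞` of
iterated-logarithm type — an explicit function and nothing more.  builds on p205010 (kernel theorem, internal audit signed;
external expert review pending). -/
theorem chiF_ge_explicit_kn [NeZero d] (hd : 3 ≤ d) (p : unitInterval) (hpc : (criticalProbI d : ℝ) < p)
    (hp : (p : ℝ) ≤ criticalProbI d + 1 / 4) (n : ℕ) :
    ENNReal.ofReal ((1 - (p : ℝ)) *
        (1 - (2 * (1 - Quant.knEta d) ^ Quant.iterCount (Quant.knLHi d) n +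
          8 * (d : ℝ) ^ 2 * (2 * n + 1 : ℝ) ^ d * ((p : ℝ) - criticalProbI d) ^ 2)) /
        (2 * d * (p : ℝ) * (2 * (1 - Quant.knEta d) ^ Quant.iterCount (Quant.knLHi d) n +
          8 * (d : ℝ) ^ 2 * (2 * n + 1 : ℝ) ^ d * ((p : ℝ) - criticalProbI d) ^ 2))) ≤
      meanClusterSize (zdGraph d) (0 : Site d) p := by
  have hpc0 : 0 < (criticalProbI d : ℝ) := by
    rw [coe_criticalProbI]; exact criticalProb_zd_pos d (by omega)
  have hpc1 : (criticalProbI d : ℝ) ≤ 1 / 2 := Quant.criticalProbI_le_half (by omega)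
  have hθ : 0 < theta (zdGraph d) 0 p :=
    theta_pos_of_criticalProb_lt_holds (zdGraph d) 0 p (by rw [← coe_criticalProbI]; exact hpc)
  exact chiF_ge_of_theta_le (by omega) p (hpc0.trans hpc) (by linarith) hθ (ThetaModulus.theta_le_kn_sum hd p hpc.le hp n)

end Corollaries

end ChiF

end Summit.CriticalPhenomena.PercolationContinuityZ3.Theorems
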